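import Summits.QuantumFields.YangMills.Theorems.OnsetTautologyOnsetContraction
import HarnessLib

/-!
# Crux `OnsetSkewLaw.RPOnsetFloor` (stmt-QuantumFields-23138), LINE «FloorInheritance» (planner ym-idea-11 g13, skeleton v5
# sha 09e801d0), registered stub `stub_cellShift` — part I: time shifts (Osterwalder–Seiler contraction), spatial shifts,
# the cell representative

The mathematics of LINE 2's tail `stub_cellShift` (the by-name file is `OnsetSkewLawRPOnsetFloorCellShift.lean`): for an
odd-torus limit state `μ` at `β ≥ 0` and a compactly supported positive-time profile `b`, every atom offset `y` (`0 ≤ y₀`) has a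
CELL representative `y' ∈ [0,s]⁴` whose reflection-positivity square (the route's text
`Σ' wr·wt·stateMomentStr μ 2`) is at least that of `y`.  THEOREMS ONLY (0 `def`, 0 `sorry`).

* §1 `rpSq_timeShift_le` — the general-`G` form of the item `OnsetTautology.OnsetContraction` (stmt-QuantumFields-28128,
  `OnsetTautologyOnsetContraction.onsetContraction_proof`, whose SU(2) hypotheses are idle; same proof, same §3 atom lemmas
  `tsum_weights_eq_integral` / `atom_cfgReflect` / `atom_configShift` imported from that module): in every odd-torus limit state at
  `β ≥ 0`, moving a compactly supported positive-time atom `m` lattice layers AWAY from the mirror does not increase its RP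
  square — site-RP of torus limit states (`GaugeBoot.siteRP_zero_of_mem_infiniteVolumeLimitPoints`, needs `0 ≤ β`),
  translation invariance, and the Osterwalder–Seiler contraction `OnsetContractionOS.osContraction`.
* §2 `rpSq_spatialShift_eq` — spatial `ℤ³`-invariance of the RP square: an offset shift by `s • k`, `k₀ = 0`, re-indexes both
  atoms by `x ↦ x + k` (the time reflection fixes `k`), and `stateMomentStr μ 2` of an odd-torus limit state depends on site
  differences only (`InfiniteVolume.stateMomentStr_translate_of_mem_oddTorusLimitPoints`).
* §3 `cellShift_core` (let-free form of the stub): `y' := y − s•⌊y/s⌋ ∈ [0,s)⁴`, `m := ⌊y₀/s⌋ ∈ ℕ`;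
  `rpSq y = rpSq (y″ + (s m)•e₀) ≤ rpSq y″ = rpSq y'` with `y″` the spatial lattice translate of `y'`.

HONEST FRAMING: bookkeeping for one M stub of an OPEN line; no crux, rung or summit is proved; the Yang–Mills mass gap is NOT
proved.  Cell `ym-idea-1`, width seat `ym-line-sfw-p2-w5` g16 (free hands).
References: K. Osterwalder, E. Seiler, Ann. Phys. 110 (1978) 440, §2 [OsterwalderSeiler1978]; K. Osterwalder, R. Schrader,
CMP 31 (1973) 83, §2 [OS1973]; J. Glimm, A. Jaffe, Quantum Physics (1987) §6.1. [folklore]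
-/

set_option autoImplicit false

noncomputable section

open scoped BigOperators
open MeasureTheory Filter Topology
open Literature.MathematicalPhysics.QuantumFieldTheory Literature.MathematicalPhysics.QuantumLattice
open Literature.Probability.LatticeModels (Site)
open Summit.QuantumFields.YangMills.Cruxes.OSLegsFromFemtoAndGap.DlrCollarTransfer
  (plane continuous_plane exists_abs_plane_le)
open Summit.QuantumFields.GaugeBoot (configSiteReflect siteHalfEdges IsReflectionPositiveFor
  siteRP_zero_of_mem_infiniteVolumeLimitPoints)
open Summit.QuantumFields.YangMills.Theorems.InfiniteVolume (stateMomentStr plane_add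
  isZdTranslationInvariant_of_mem_oddTorusLimitPoints stateMomentStr_translate_of_mem_oddTorusLimitPoints)
open Summit.QuantumFields.YangMills.Theorems.InfVolRP (reflSite plane_cfgReflect smul_reflSite_add_of_centre
  integral_plane_eq_integral_plane_zero mem_infiniteVolumeLimitPoints_of_mem_oddTorusLimitPoints centreOffset
  two_mul_centreOffset_zero centreOffset_time)
open Summit.QuantumFields.YangMills.Theorems.OnsetContractionOS (osContraction)
open Summit.QuantumFields.YangMills.Theorems.OnsetTautologyOnsetContraction (tsum_weights_eq_integral atom_cfgReflect
  atom_configShift abs_coord_le_of_ne_zero abs_centredPlane_le)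

namespace Summit.QuantumFields.YangMills.Theorems.RPOnsetFloorCellShift

variable {G : Type} [Group G] [TopologicalSpace G] [IsTopologicalGroup G] [CompactSpace G]
  [MeasurableSpace G] [BorelSpace G]

/-! ## §1 Time shifts away from the mirror do not increase the RP square (every compact `G`) -/

/-- **General-`G` `OnsetContraction`.**  In every odd-torus limit state at `β ≥ 0`, translating the atom
`Σ_{q ∈ Q, x} b(s(x + o_q) − y)·P_q(x)` of a compactly supported positive-time profile `b` (offset `y`, `0 ≤ y₀`) UP by `m`
lattice units does not increase its reflection-positivity square `Σ' wr·wt·stateMomentStr μ 2` (the route's text).  This is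
`OnsetTautologyOnsetContraction.onsetContraction_proof` with its idle SU(2) hypotheses removed (same proof).
[cite: OsterwalderSeiler1978, §2] -/
theorem rpSq_timeShift_le (r : LatticeRep G) {β : ℝ} (hβ : 0 ≤ β) {μ : Measure (LGConfig 4 G)}
    (hμ : μ ∈ oddTorusLimitPoints r β) {b : EuclideanSpace ℝ (Fin 4) → ℝ} (hb : HasCompactSupport b)
    (hbsupp : tsupport b ⊆ {u : EuclideanSpace ℝ (Fin 4) | 0 < u 0}) (Q : Finset (Fin 4 × Fin 4)) {s : ℝ}
    (hs : 0 < s) {y : EuclideanSpace ℝ (Fin 4)} (hy : 0 ≤ y 0) (m : ℕ) :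
    (∑' pp : ((Fin 4 × Fin 4) × (Fin 4 → ℤ)) × ((Fin 4 × Fin 4) × (Fin 4 → ℤ)),
        (if pp.1.1 ∈ Q ∧ pp.1.1.1 < pp.1.1.2 then
            b (timeReflection 4 (s • (siteToE pp.1.2 + centreOffset pp.1.1)) -
              (y + (s * m) • EuclideanSpace.single 0 (1 : ℝ))) else 0) *
        (if pp.2.1 ∈ Q ∧ pp.2.1.1 < pp.2.1.2 then
            b (s • (siteToE pp.2.2 + centreOffset pp.2.1) - (y + (s * m) • EuclideanSpace.single 0 (1 : ℝ))) else 0) *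
        stateMomentStr G r μ 2 ![pp.1.1, pp.2.1] ![pp.1.2, pp.2.2]) ≤
      ∑' pp : ((Fin 4 × Fin 4) × (Fin 4 → ℤ)) × ((Fin 4 × Fin 4) × (Fin 4 → ℤ)),
        (if pp.1.1 ∈ Q ∧ pp.1.1.1 < pp.1.1.2 then
            b (timeReflection 4 (s • (siteToE pp.1.2 + centreOffset pp.1.1)) - y) else 0) *
        (if pp.2.1 ∈ Q ∧ pp.2.1.1 < pp.2.1.2 then b (s • (siteToE pp.2.2 + centreOffset pp.2.1) - y) else 0) *
        stateMomentStr G r μ 2 ![pp.1.1, pp.2.1] ![pp.1.2, pp.2.2] := by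
  haveI : SecondCountableTopology G :=
    (r.continuous.isClosedEmbedding r.injective).isEmbedding.secondCountableTopology
  haveI : T2Space G := (r.continuous.isClosedEmbedding r.injective).isEmbedding.t2Space
  -- the two weight families of the route, as functions of the offset
  set wt : EuclideanSpace ℝ (Fin 4) → (Fin 4 × Fin 4) × Site 4 → ℝ :=
    fun z p => if p.1 ∈ Q ∧ p.1.1 < p.1.2 then b (s • (siteToE p.2 + centreOffset p.1) - z) else 0 with hwt
  set wr : EuclideanSpace ℝ (Fin 4) → (Fin 4 × Fin 4) × Site 4 → ℝ :=
    fun z p => if p.1 ∈ Q ∧ p.1.1 < p.1.2 then b (timeReflection 4 (s • (siteToE p.2 + centreOffset p.1)) - z) else 0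
    with hwr
  -- the state: probability, translation invariant, site-RP
  have hμ' := mem_infiniteVolumeLimitPoints_of_mem_oddTorusLimitPoints r hμ
  obtain ⟨-, -, hprob, -⟩ := id hμ'
  have hTI : IsZdTranslationInvariant μ := isZdTranslationInvariant_of_mem_oddTorusLimitPoints r hμ
  have hRP : IsReflectionPositiveFor (configSiteReflect (G := G) 0) (siteHalfEdges 0) μ :=
    siteRP_zero_of_mem_infiniteVolumeLimitPoints r.ρ r.continuous hβ hμ'
  -- the translated offset
  set y' : EuclideanSpace ℝ (Fin 4) := y + (s * (m : ℝ)) • EuclideanSpace.single 0 (1 : ℝ) with hy'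
  set v : Site 4 := Pi.single 0 (m : ℤ) with hv
  -- a box containing the support of all four weight functions
  obtain ⟨R, hR⟩ : ∃ R : ℝ, Function.support b ⊆ Metric.closedBall 0 R := by
    obtain ⟨R, hR⟩ := (hb.isCompact.isBounded).subset_closedBall (0 : EuclideanSpace ℝ (Fin 4))
    exact ⟨R, (subset_tsupport _).trans hR⟩
  set B : ℕ := ⌈(R + (‖y‖ + s * m)) / s + 1⌉₊ with hB
  set S : Finset ((Fin 4 × Fin 4) × Site 4) :=
    Finset.univ ×ˢ Fintype.piFinset (fun _ : Fin 4 => Finset.Icc (-(B : ℤ)) B) with hS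
  have hy'norm : ‖y'‖ ≤ ‖y‖ + s * m := by
    rw [hy']
    refine (norm_add_le _ _).trans (add_le_add le_rfl ?_)
    rw [norm_smul, PiLp.norm_single, norm_one, mul_one, Real.norm_eq_abs, abs_of_nonneg (by positivity)]
  have hmemS : ∀ (x : Site 4) (q : Fin 4 × Fin 4), (∀ i, |(x i : ℝ)| ≤ (R + (‖y‖ + s * m)) / s + 1) → (q, x) ∈ S := by
    intro x q hx
    simp only [hS, Finset.mem_product, Finset.mem_univ, true_and, Fintype.mem_piFinset, Finset.mem_Icc]
    intro i
    have h1 : |(x i : ℝ)| ≤ (B : ℝ) := (hx i).trans (Nat.le_ceil _)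
    have h2 : |x i| ≤ (B : ℤ) := by exact_mod_cast h1
    exact abs_le.1 h2
  -- vanishing of the weights off `S`, for an offset `z` with `‖z‖ ≤ ‖y‖ + s m`
  have hvanish : ∀ z : EuclideanSpace ℝ (Fin 4), ‖z‖ ≤ ‖y‖ + s * m →
      (∀ p ∉ S, wt z p = 0) ∧ (∀ p ∉ S, wr z p = 0) := by
    intro z hz
    have key : ∀ (p : (Fin 4 × Fin 4) × Site 4) (w : EuclideanSpace ℝ (Fin 4)),
        ‖w‖ = ‖s • (siteToE p.2 + centreOffset p.1)‖ → p ∉ S → b (w - z) = 0 := by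
      intro p w hw hp
      by_contra hne
      refine hp (hmemS p.2 p.1 fun i => ?_)
      have h := abs_coord_le_of_ne_zero hR hs (InfVolRP.norm_centreOffset_le_one p.1) p.2 z w hw hne i
      have hmono : (R + ‖z‖) / s + 1 ≤ (R + (‖y‖ + s * m)) / s + 1 := by
        have := div_le_div_of_nonneg_right (c := s) (by linarith : R + ‖z‖ ≤ R + (‖y‖ + s * m)) hs.le
        linarith
      exact h.trans hmono
    refine ⟨fun p hp => ?_, fun p hp => ?_⟩
    · show (if p.1 ∈ Q ∧ p.1.1 < p.1.2 then b (s • (siteToE p.2 + centreOffset p.1) - z) else 0) = 0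
      rw [key p _ rfl hp, ite_self]
    · show (if p.1 ∈ Q ∧ p.1.1 < p.1.2 then b (timeReflection 4 (s • (siteToE p.2 + centreOffset p.1)) - z) else 0) = 0
      rw [key p _ (LinearIsometryEquiv.norm_map _ _) hp, ite_self]
  obtain ⟨hwtS, hwrS⟩ := hvanish y (by linarith [mul_nonneg hs.le (Nat.cast_nonneg m)])
  obtain ⟨hwtS', hwrS'⟩ := hvanish y' hy'norm
  -- the mirror identity `wt z (q, reflSite q x) = wr z (q, x)` (plaquette-centre smearing)
  have hmirror : ∀ (z : EuclideanSpace ℝ (Fin 4)) (p : (Fin 4 × Fin 4) × Site 4),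
      wt z (p.1, reflSite p.1 p.2) = wr z p := by
    intro z p
    show (if p.1 ∈ Q ∧ p.1.1 < p.1.2 then b (s • (siteToE (reflSite p.1 p.2) + centreOffset p.1) - z) else 0) =
      (if p.1 ∈ Q ∧ p.1.1 < p.1.2 then b (timeReflection 4 (s • (siteToE p.2 + centreOffset p.1)) - z) else 0)
    by_cases hq : p.1 ∈ Q ∧ p.1.1 < p.1.2
    · rw [if_pos hq, if_pos hq, smul_reflSite_add_of_centre s p.1 p.2 _ (two_mul_centreOffset_zero hq.2)]
    · rw [if_neg hq, if_neg hq]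
  -- the shift identity `wt y (q, x - v) = wt y' (q, x)`
  have hshift : ∀ p : (Fin 4 × Fin 4) × Site 4, wt y (p.1, p.2 - v) = wt y' p := by
    intro p
    show (if p.1 ∈ Q ∧ p.1.1 < p.1.2 then b (s • (siteToE (p.2 - v) + centreOffset p.1) - y) else 0) =
      (if p.1 ∈ Q ∧ p.1.1 < p.1.2 then b (s • (siteToE p.2 + centreOffset p.1) - y') else 0)
    have hpt : s • (siteToE (p.2 - v) + centreOffset p.1) - y = s • (siteToE p.2 + centreOffset p.1) - y' := by
      rw [hy', hv]
      ext i
      simp only [PiLp.sub_apply, PiLp.smul_apply, PiLp.add_apply, siteToE_apply, Pi.sub_apply, smul_eq_mul,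
        PiLp.single_apply]
      by_cases hi : i = 0
      · subst hi; simp only [Pi.single_eq_same, ↓reduceIte]; push_cast; ring
      · simp only [Pi.single_eq_of_ne hi, hi, ↓reduceIte]; push_cast; ring
    rw [hpt]
  -- the weights vanish on invalid orientations
  have hvalid : ∀ (z : EuclideanSpace ℝ (Fin 4)) (p : (Fin 4 × Fin 4) × Site 4), ¬ p.1.1 < p.1.2 → wt z p = 0 := by
    intro z p hq
    show (if p.1 ∈ Q ∧ p.1.1 < p.1.2 then b (s • (siteToE p.2 + centreOffset p.1) - z) else 0) = 0
    rw [if_neg (fun h => hq h.2)]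
  -- the atom `A` of `y` and its three avatars
  have hsq : ∀ z : EuclideanSpace ℝ (Fin 4), (∀ p ∉ S, wt z p = 0) → (∀ p ∉ S, wr z p = 0) →
      (∑' pp : ((Fin 4 × Fin 4) × Site 4) × ((Fin 4 × Fin 4) × Site 4),
        wr z pp.1 * wt z pp.2 * stateMomentStr G r μ 2 ![pp.1.1, pp.2.1] ![pp.1.2, pp.2.2]) =
      ∫ U, (∑ p ∈ S, wt z p * (plane G r p.1 p.2 (cfgReflect U) - ∫ V, plane G r p.1 p.2 V ∂μ)) *
        (∑ p ∈ S, wt z p * (plane G r p.1 p.2 U - ∫ V, plane G r p.1 p.2 V ∂μ)) ∂μ := by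
    intro z hzt hzr
    rw [tsum_weights_eq_integral r μ S (wr z) (wt z) hzr hzt]
    refine integral_congr_ae (Eventually.of_forall fun U => ?_)
    simp only
    rw [atom_cfgReflect r hTI S (wt z) (wr z) (hvalid z) (hmirror z) hzt hzr U]
  -- the atom of `y'` is the atom of `y` translated up by `m`
  have hA' : ∀ U : LGConfig 4 G, (∑ p ∈ S, wt y' p * (plane G r p.1 p.2 U - ∫ V, plane G r p.1 p.2 V ∂μ)) =
      ∑ p ∈ S, wt y p * (plane G r p.1 p.2 (configShift (-v) U) - ∫ V, plane G r p.1 p.2 V ∂μ) := fun U =>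
    (atom_configShift r hTI S (wt y) (wt y') v hshift hwtS hwtS' U).symm
  -- properties of the atom `A`
  obtain ⟨Cp, hCp⟩ := exists_abs_plane_le (G := G) r
  have hAm : Measurable fun U => ∑ p ∈ S, wt y p * (plane G r p.1 p.2 U - ∫ V, plane G r p.1 p.2 V ∂μ) :=
    Finset.measurable_sum _ fun p _ => ((continuous_plane r p.1 p.2).measurable.sub measurable_const).const_mul _
  have hAb : ∃ C, ∀ U, |∑ p ∈ S, wt y p * (plane G r p.1 p.2 U - ∫ V, plane G r p.1 p.2 V ∂μ)| ≤ C := by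
    refine ⟨∑ p ∈ S, |wt y p| * (2 * Cp), fun U => (Finset.abs_sum_le_sum_abs _ _).trans
      (Finset.sum_le_sum fun p _ => ?_)⟩
    rw [abs_mul]
    exact mul_le_mul_of_nonneg_left (abs_centredPlane_le r μ hCp p.1 p.2 U) (abs_nonneg _)
  have htime : ∀ p : (Fin 4 × Fin 4) × Site 4, wt y p ≠ 0 → 0 ≤ p.2 0 := by
    intro p hp
    have hp' : (if p.1 ∈ Q ∧ p.1.1 < p.1.2 then b (s • (siteToE p.2 + centreOffset p.1) - y) else 0) ≠ 0 := hp
    rw [ne_eq, ite_eq_right_iff, Classical.not_imp] at hp'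
    obtain ⟨-, hne⟩ := hp'
    have hmem : s • (siteToE p.2 + centreOffset p.1) - y ∈ {u : EuclideanSpace ℝ (Fin 4) | 0 < u 0} :=
      hbsupp (subset_tsupport _ hne)
    simp only [Set.mem_setOf_eq, PiLp.sub_apply, PiLp.smul_apply, PiLp.add_apply, siteToE_apply, smul_eq_mul] at hmem
    have ho := centreOffset_time p.1
    by_contra hneg
    push Not at hneg
    have h1 : (p.2 0 : ℝ) ≤ -1 := by exact_mod_cast (show p.2 0 ≤ -1 by omega)
    have h2 : (p.2 0 : ℝ) + centreOffset p.1 0 < 0 := by linarith [ho.2]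
    have h3 : s * ((p.2 0 : ℝ) + centreOffset p.1 0) < 0 := mul_neg_of_pos_of_neg hs h2
    linarith
  have hAd : DependsOn (fun U => ∑ p ∈ S, wt y p * (plane G r p.1 p.2 U - ∫ V, plane G r p.1 p.2 V ∂μ))
      (siteHalfEdges (d := 4) 0) := by
    intro U W hUW
    refine Finset.sum_congr rfl fun p _ => ?_
    by_cases hp : wt y p = 0
    · simp only [hp, zero_mul]
    · rw [InfVolRP.dependsOn_plane r p.1 (htime p hp) hUW]
  -- assemble
  show (∑' pp : ((Fin 4 × Fin 4) × Site 4) × ((Fin 4 × Fin 4) × Site 4),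
        wr y' pp.1 * wt y' pp.2 * stateMomentStr G r μ 2 ![pp.1.1, pp.2.1] ![pp.1.2, pp.2.2]) ≤
      ∑' pp : ((Fin 4 × Fin 4) × Site 4) × ((Fin 4 × Fin 4) × Site 4),
        wr y pp.1 * wt y pp.2 * stateMomentStr G r μ 2 ![pp.1.1, pp.2.1] ![pp.1.2, pp.2.2]
  rw [hsq y' hwtS' hwrS', hsq y hwtS hwrS]
  simp_rw [hA']
  exact osContraction hRP hTI hAm hAb hAd m


/-! ## §2 Spatial lattice shifts leave the RP square invariant -/

/-- **Spatial `ℤ³`-invariance of the RP square.**  For an odd-torus limit state, shifting the offset of both atoms by `s • k`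
with a SPATIAL lattice vector `k` (`k 0 = 0`) does not change the route's RP square: both weight families are re-indexed by
`x ↦ x + k` (the time reflection fixes `k`), and `stateMomentStr μ 2` depends on the sites only through their difference
(`stateMomentStr_translate_of_mem_oddTorusLimitPoints`).  Any profile `b`, any `Q`, any real `s`. [folklore] -/
theorem rpSq_spatialShift_eq (r : LatticeRep G) {β : ℝ} {μ : Measure (LGConfig 4 G)}
    (hμ : μ ∈ oddTorusLimitPoints r β) (b : EuclideanSpace ℝ (Fin 4) → ℝ) (Q : Finset (Fin 4 × Fin 4)) (s : ℝ)
    (y : EuclideanSpace ℝ (Fin 4)) {k : Fin 4 → ℤ} (hk : k 0 = 0) :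
    (∑' pp : ((Fin 4 × Fin 4) × (Fin 4 → ℤ)) × ((Fin 4 × Fin 4) × (Fin 4 → ℤ)),
        (if pp.1.1 ∈ Q ∧ pp.1.1.1 < pp.1.1.2 then
            b (timeReflection 4 (s • (siteToE pp.1.2 + centreOffset pp.1.1)) - (y + s • siteToE k)) else 0) *
        (if pp.2.1 ∈ Q ∧ pp.2.1.1 < pp.2.1.2 then
            b (s • (siteToE pp.2.2 + centreOffset pp.2.1) - (y + s • siteToE k)) else 0) *
        stateMomentStr G r μ 2 ![pp.1.1, pp.2.1] ![pp.1.2, pp.2.2]) =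
      ∑' pp : ((Fin 4 × Fin 4) × (Fin 4 → ℤ)) × ((Fin 4 × Fin 4) × (Fin 4 → ℤ)),
        (if pp.1.1 ∈ Q ∧ pp.1.1.1 < pp.1.1.2 then
            b (timeReflection 4 (s • (siteToE pp.1.2 + centreOffset pp.1.1)) - y) else 0) *
        (if pp.2.1 ∈ Q ∧ pp.2.1.1 < pp.2.1.2 then b (s • (siteToE pp.2.2 + centreOffset pp.2.1) - y) else 0) *
        stateMomentStr G r μ 2 ![pp.1.1, pp.2.1] ![pp.1.2, pp.2.2] := by
  -- re-index the right-hand side by `x ↦ x + k` in both slots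
  rw [← Equiv.tsum_eq (Equiv.prodCongr (Equiv.prodCongr (Equiv.refl (Fin 4 × Fin 4)) (Equiv.addRight k))
    (Equiv.prodCongr (Equiv.refl (Fin 4 × Fin 4)) (Equiv.addRight k)))]
  refine (tsum_congr fun pp => ?_).symm
  obtain ⟨⟨q₁, x₁⟩, ⟨q₂, x₂⟩⟩ := pp
  simp only [Equiv.prodCongr_apply, Prod.map_apply, Equiv.coe_refl, id_eq, Equiv.coe_addRight]
  -- the three factors agree
  have h1 : timeReflection 4 (s • (siteToE (x₁ + k) + centreOffset q₁)) - (y + s • siteToE k) =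
      timeReflection 4 (s • (siteToE x₁ + centreOffset q₁)) - y := by
    ext i
    simp only [PiLp.sub_apply, PiLp.add_apply, PiLp.smul_apply, timeReflection_apply, siteToE_apply, Pi.add_apply,
      Int.cast_add, smul_eq_mul]
    by_cases hi : i = 0
    · subst hi; simp only [↓reduceIte, hk, Int.cast_zero]; ring
    · simp only [hi, ↓reduceIte]; ring
  have h2 : s • (siteToE (x₂ + k) + centreOffset q₂) - (y + s • siteToE k) =
      s • (siteToE x₂ + centreOffset q₂) - y := by
    ext i
    simp only [PiLp.sub_apply, PiLp.add_apply, PiLp.smul_apply, siteToE_apply, Pi.add_apply, Int.cast_add, smul_eq_mul]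
    ring
  have h3 : stateMomentStr G r μ 2 ![q₁, q₂] ![x₁ + k, x₂ + k] = stateMomentStr G r μ 2 ![q₁, q₂] ![x₁, x₂] := by
    have h := stateMomentStr_translate_of_mem_oddTorusLimitPoints r hμ 2 ![q₁, q₂] ![x₁, x₂] k
    have hx : (fun i => (![x₁, x₂] : Fin 2 → Site 4) i + k) = ![x₁ + k, x₂ + k] := by
      funext i
      fin_cases i <;> simp
    rw [hx] at h
    exact h
  rw [h1, h2, h3]


/-! ## §3 The cell representative -/

/-- **Cell representative (let-free core of `stub_cellShift`).**  For an odd-torus limit state at `β ≥ 0`, a compactly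
supported positive-time profile `b`, an orientation `q`, a resolution `s > 0` and an offset `y` with `0 ≤ y₀`, there is
`y' ∈ [0,s]⁴` with `rpSq {q} s y ≤ rpSq {q} s y'` (the route's RP-square text, spelled out): `y' = y − s•⌊y/s⌋`, reached by a
spatial lattice shift (§2, equality) and a time shift by `⌊y₀/s⌋` layers towards the mirror (§1, monotone). [folklore] -/
theorem cellShift_core (r : LatticeRep G) {β : ℝ} (hβ : 0 ≤ β) {μ : Measure (LGConfig 4 G)}
    (hμ : μ ∈ oddTorusLimitPoints r β) {b : EuclideanSpace ℝ (Fin 4) → ℝ} (hb : HasCompactSupport b)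
    (hbsupp : tsupport b ⊆ {u : EuclideanSpace ℝ (Fin 4) | 0 < u 0}) (q : Fin 4 × Fin 4) {s : ℝ} (hs : 0 < s)
    (y : EuclideanSpace ℝ (Fin 4)) (hy : 0 ≤ y 0) :
    ∃ y' : EuclideanSpace ℝ (Fin 4), (∀ i, 0 ≤ y' i ∧ y' i ≤ s) ∧
      (∑' pp : ((Fin 4 × Fin 4) × (Fin 4 → ℤ)) × ((Fin 4 × Fin 4) × (Fin 4 → ℤ)),
        (if pp.1.1 ∈ ({q} : Finset (Fin 4 × Fin 4)) ∧ pp.1.1.1 < pp.1.1.2 then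
            b (timeReflection 4 (s • (siteToE pp.1.2 + centreOffset pp.1.1)) - y) else 0) *
        (if pp.2.1 ∈ ({q} : Finset (Fin 4 × Fin 4)) ∧ pp.2.1.1 < pp.2.1.2 then
            b (s • (siteToE pp.2.2 + centreOffset pp.2.1) - y) else 0) *
        stateMomentStr G r μ 2 ![pp.1.1, pp.2.1] ![pp.1.2, pp.2.2]) ≤
      ∑' pp : ((Fin 4 × Fin 4) × (Fin 4 → ℤ)) × ((Fin 4 × Fin 4) × (Fin 4 → ℤ)),
        (if pp.1.1 ∈ ({q} : Finset (Fin 4 × Fin 4)) ∧ pp.1.1.1 < pp.1.1.2 then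
            b (timeReflection 4 (s • (siteToE pp.1.2 + centreOffset pp.1.1)) - y') else 0) *
        (if pp.2.1 ∈ ({q} : Finset (Fin 4 × Fin 4)) ∧ pp.2.1.1 < pp.2.1.2 then
            b (s • (siteToE pp.2.2 + centreOffset pp.2.1) - y') else 0) *
        stateMomentStr G r μ 2 ![pp.1.1, pp.2.1] ![pp.1.2, pp.2.2] := by
  -- integer parts of the offset in units of `s`
  set k : Fin 4 → ℤ := fun i => ⌊y i / s⌋ with hk
  have hk0 : 0 ≤ k 0 := Int.floor_nonneg.2 (div_nonneg hy hs.le)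
  obtain ⟨m, hm⟩ : ∃ m : ℕ, (m : ℤ) = k 0 := ⟨(k 0).toNat, Int.toNat_of_nonneg hk0⟩
  have hmR : ((k 0 : ℤ) : ℝ) = (m : ℝ) := by rw [← hm, Int.cast_natCast]
  -- the spatial part of `k`
  set k' : Fin 4 → ℤ := fun i => if i = 0 then 0 else k i with hk'
  have hk'0 : k' 0 = 0 := by simp [hk']
  -- the cell representative
  obtain ⟨y', hy'⟩ : ∃ y' : EuclideanSpace ℝ (Fin 4), y' = y - s • siteToE k := ⟨_, rfl⟩
  have hy'i : ∀ i, y' i = y i - ⌊y i / s⌋ * s := fun i => by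
    rw [hy', PiLp.sub_apply, PiLp.smul_apply, siteToE_apply, smul_eq_mul, mul_comm]
  refine ⟨y', fun i => ⟨?_, ?_⟩, ?_⟩
  · rw [hy'i]; exact Int.sub_floor_div_mul_nonneg _ hs
  · rw [hy'i]; exact (Int.sub_floor_div_mul_lt _ hs).le
  -- `y = (y' + s • k') + (s m) • e₀`
  have hy'0 : 0 ≤ (y' + s • siteToE k') 0 := by
    rw [PiLp.add_apply, PiLp.smul_apply, siteToE_apply, hk'0, Int.cast_zero, smul_eq_mul, mul_zero, add_zero, hy'i]
    exact Int.sub_floor_div_mul_nonneg _ hs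
  have hdecomp : y = (y' + s • siteToE k') + (s * (m : ℝ)) • EuclideanSpace.single 0 (1 : ℝ) := by
    ext i
    simp only [hy', PiLp.add_apply, PiLp.sub_apply, PiLp.smul_apply, siteToE_apply, smul_eq_mul, PiLp.single_apply, hk']
    by_cases hi : i = 0
    · subst hi; simp only [↓reduceIte, Int.cast_zero, ← hmR]; ring
    · simp only [hi, ↓reduceIte]; ring
  have hT := rpSq_timeShift_le r hβ hμ hb hbsupp {q} hs hy'0 m
  have hS := rpSq_spatialShift_eq r hμ b {q} s y' hk'0
  rw [hdecomp]
  exact hT.trans hS.le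

end Summit.QuantumFields.YangMills.Theorems.RPOnsetFloorCellShift

end
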